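import Summits.CriticalPhenomena.PercolationContinuityZ3.Theorems.Transplant.PatternGraphOrbits
import Summits.CriticalPhenomena.PercolationContinuityZ3.Theorems.Transplant.HeisenbergDecoratedBilayer
import HarnessLib

/-!
# A first customer of the pattern-graph front-end in class C2: the HEISENBERG SKEW BILAYER (the coset picture of `Cay(H₃(ℤ) ⋊ C₂; a, b, aσ, bσ)`) —
# `θ_v(p_c) = 0 ∧ p_c < 1` UNCONDITIONALLY

builds on p205010 (kernel theorem, internal audit signed; external expert review pending): through `PatternGraph.criticalContinuity/conj4` («PatternGraphOrbits», this seat)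
over the orbit theorem («AutChartOrbitsCriticalContinuity» p493117/p495338).  Lane `prim-bschramm`, seat `prim-bschramm-p3` gen 28 (design owner; P3-NILPOTENT §20.2 (c1),
§20.7).  Helper file (`--supports stmt-CriticalPhenomena-4575 --as helper`).

THE GRAPH.  Vertices `H₃(ℤ) × Fin 2`; pattern `P 0 = {a^{±1}, b^{±1} (sheet 0), a, b (into sheet 1)}`, `P 1 = {a^{±1}, b^{±1} (sheet 1), a⁻¹, b⁻¹ (into sheet 0)}`:
bonds `(h, j) ∼ (h a^{±1}, j)`, `(h, j) ∼ (h b^{±1}, j)` and the SKEW rungs `(h, 0) ∼ (h a, 1)`, `(h, 0) ∼ (h b, 1)`.  This is the right Cayley graph of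
`Γ = H₃(ℤ) ⋊ C₂` (`σ : (x,y,z) ↦ (−x,−y,z)`) on the alphabet `{a^{±1}, b^{±1}, aσ, bσ}` (`aσ`, `bσ` involutions) read on the two cosets of `H₃(ℤ)`
(`hσ · aσ = h a⁻¹`) — an identification stated in coordinates, NOT typed here; `Γ` is virtually nilpotent, not nilpotent, with finite abelianisation.  WORDS (rule
P5-SHARPNESS §59.3, P3-NILPOTENT §20.7): the graph is vertex-transitive (as every Cayley graph); whether some transitive group of automorphisms translates a rank-two
chart (which would put it under V153's clause 3) is OPEN — no element of `Γ ∖ H₃` normalises the alphabet, other automorphisms are not excluded; so this file is a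
CUSTOMER of the orbit theorem, and no 'first' / 'outside' word is attached to it.  Kernel content: `θ_v(p_c) = 0` and `p_c < 1` on the explicit graph
`PatternGraph.graph Heis3Skew.P`.
[cite: BenjaminiSchramm1996, Conj. 4; §2 (Cayley graphs, quasi-transitive graphs)] [cite: KozmaNitzan2024, §4 p. 16 (Lemma 8)]
-/

noncomputable section

namespace Summit.CriticalPhenomena.PercolationContinuityZ3.Theorems.Transplant

open MeasureTheory Literature.Probability.Percolation Literature.Probability.LatticeModels SimpleGraph
open scoped Classical

namespace Heis3Skew

open Heis3 (gA gB gC φ φ_mul)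

/-- **The abelianisation of `H₃(ℤ)` as a homomorphism to `Multiplicative ℤ²`.** [folklore] -/
def abHom : Heis3 →* Multiplicative (Site 2) where
  toFun g := Multiplicative.ofAdd (φ g)
  map_one' := by rw [Heis3Bilayer.φ_one_eq, ofAdd_zero]
  map_mul' g h := by rw [φ_mul, ofAdd_add]

/-- `toAdd (abHom g) = φ g`. [folklore] -/
@[simp] theorem toAdd_abHom (g : Heis3) : Multiplicative.toAdd (abHom g) = φ g := rfl

/-- The letters of sheet `0`: in-sheet `a^{±1}`, `b^{±1}` and the skew rungs `a, b` into sheet `1`. [this work] -/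
def P0 : Finset (Heis3 × Fin 2) := {(gA, 0), (gA⁻¹, 0), (gB, 0), (gB⁻¹, 0), (gA, 1), (gB, 1)}

/-- The letters of sheet `1`: in-sheet `a^{±1}`, `b^{±1}` and the reversed rungs `a⁻¹, b⁻¹` into sheet `0` (the same bonds). [this work] -/
def P1 : Finset (Heis3 × Fin 2) := {(gA, 1), (gA⁻¹, 1), (gB, 1), (gB⁻¹, 1), (gA⁻¹, 0), (gB⁻¹, 0)}

/-- **The pattern of the Heisenberg skew bilayer.** [this work] -/
def P : Fin 2 → Finset (Heis3 × Fin 2) := fun j => if j = 0 then P0 else P1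

/-- The letters of sheet `0`. [folklore] -/
theorem P_zero : P 0 = P0 := if_pos rfl

/-- The letters of sheet `1`. [folklore] -/
theorem P_one : P 1 = P1 := if_neg (by decide)

/-- The letters of a sheet other than `0`. [folklore] -/
theorem P_of_ne {j : Fin 2} (hj : j ≠ 0) : P j = P1 := if_neg hj

/-- The chart values of the letters `a^{±1}`, `b^{±1}` have sup-norm `≤ 1`. [folklore] -/
theorem abs_φ_letter_le {g : Heis3} (hg : g = gA ∨ g = gA⁻¹ ∨ g = gB ∨ g = gB⁻¹) (i : Fin 2) : |φ g i| ≤ 1 := by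
  rcases hg with rfl | rfl | rfl | rfl <;> fin_cases i <;> simp [φ, gA, gB]

/-- **Unit range**: every pattern letter has chart sup-norm `≤ 1`. [folklore] -/
theorem hrange : ∀ j : Fin 2, ∀ p ∈ P j, ∀ i : Fin 2, |Multiplicative.toAdd (abHom p.1) i| ≤ 1 := by
  intro j p hp i
  rw [toAdd_abHom]
  by_cases hj : j = 0
  · subst hj
    rw [P_zero, P0] at hp
    simp only [Finset.mem_insert, Finset.mem_singleton] at hp
    rcases hp with rfl | rfl | rfl | rfl | rfl | rfl
    · exact abs_φ_letter_le (Or.inl rfl) i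
    · exact abs_φ_letter_le (Or.inr (Or.inl rfl)) i
    · exact abs_φ_letter_le (Or.inr (Or.inr (Or.inl rfl))) i
    · exact abs_φ_letter_le (Or.inr (Or.inr (Or.inr rfl))) i
    · exact abs_φ_letter_le (Or.inl rfl) i
    · exact abs_φ_letter_le (Or.inr (Or.inr (Or.inl rfl))) i
  · rw [P_of_ne hj, P1] at hp
    simp only [Finset.mem_insert, Finset.mem_singleton] at hp
    rcases hp with rfl | rfl | rfl | rfl | rfl | rfl
    · exact abs_φ_letter_le (Or.inl rfl) i
    · exact abs_φ_letter_le (Or.inr (Or.inl rfl)) i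
    · exact abs_φ_letter_le (Or.inr (Or.inr (Or.inl rfl))) i
    · exact abs_φ_letter_le (Or.inr (Or.inr (Or.inr rfl))) i
    · exact abs_φ_letter_le (Or.inr (Or.inl rfl)) i
    · exact abs_φ_letter_le (Or.inr (Or.inr (Or.inr rfl))) i

/-- `φ a = e₀`, `φ a⁻¹ = −e₀`, `φ b = e₁`, `φ b⁻¹ = −e₁`. [folklore] -/
theorem φ_letters : φ gA = Pi.single 0 1 ∧ φ gA⁻¹ = Pi.single 0 (-1) ∧ φ gB = Pi.single 1 1 ∧ φ gB⁻¹ = Pi.single 1 (-1) := by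
  refine ⟨?_, ?_, ?_, ?_⟩ <;> funext i <;> fin_cases i <;> simp [φ, gA, gB]

/-- **In-sheet axis steps**: every sheet carries `a^{±1}`, `b^{±1}`. [folklore] -/
theorem hstep : ∀ (j : Fin 2) (i : Fin 2) (σ : ℤˣ), ∃ p ∈ P j, p.2 = j ∧ Multiplicative.toAdd (abHom p.1) = Pi.single i (σ : ℤ) := by
  intro j i σ
  obtain ⟨hA, hA', hB, hB'⟩ := φ_letters
  -- the letter `a^{σ}` (axis 0) or `b^{σ}` (axis 1) of sheet `j`
  have hmem : ∀ g : Heis3, (g = gA ∨ g = gA⁻¹ ∨ g = gB ∨ g = gB⁻¹) → (g, j) ∈ P j := by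
    intro g hg
    by_cases hj : j = 0
    · subst hj; rw [P_zero, P0]; rcases hg with rfl | rfl | rfl | rfl <;> simp
    · rw [P_of_ne hj, P1]
      have hj1 : j = 1 := by
        obtain ⟨v, hv⟩ := j
        interval_cases v
        · exact absurd rfl hj
        · rfl
      subst hj1; rcases hg with rfl | rfl | rfl | rfl <;> simp
  rcases Int.units_eq_one_or σ with rfl | rfl <;> fin_cases i
  · exact ⟨(gA, j), hmem gA (Or.inl rfl), rfl, by rw [toAdd_abHom, Units.val_one]; exact hA⟩
  · exact ⟨(gB, j), hmem gB (Or.inr (Or.inr (Or.inl rfl))), rfl, by rw [toAdd_abHom, Units.val_one]; exact hB⟩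
  · exact ⟨(gA⁻¹, j), hmem gA⁻¹ (Or.inr (Or.inl rfl)), rfl, by rw [toAdd_abHom, Units.val_neg, Units.val_one]; exact hA'⟩
  · exact ⟨(gB⁻¹, j), hmem gB⁻¹ (Or.inr (Or.inr (Or.inr rfl))), rfl, by rw [toAdd_abHom, Units.val_neg, Units.val_one]; exact hB'⟩

/-- **The skew bilayer is connected** (sheet `0` generated by `a, b`; both sheets carry a letter into sheet `0`). [folklore] -/
theorem connected : (PatternGraph.graph P).Connected := by
  refine PatternGraph.connected_of_links P 0 (fun g => ?_) (fun j => ?_)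
  · refine PatternGraph.reachable_sheet P (S := ((({gA, gB} : Finset Heis3) : Set Heis3))) (Heis3.closure_eq_top_of_mem (by simp) (by simp)) 0 ?_ g
    intro s hs
    simp only [Finset.coe_insert, Finset.coe_singleton, Set.mem_insert_iff, Set.mem_singleton_iff] at hs
    rcases hs with rfl | rfl <;> simp [P_zero, P0]
  · fin_cases j
    · exact ⟨gA, by simp [P_zero, P0]⟩
    · exact ⟨gA⁻¹, by simp [P_one, P1]⟩

/-- **THEOREM (unconditional).  `θ_v(p_c) = 0` at every vertex of the Heisenberg skew bilayer** (the coset picture of `Cay(H₃(ℤ) ⋊ C₂; a, b, aσ, bσ)`).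
builds on p205010 (kernel theorem, internal audit signed; external expert review pending). [cite: BenjaminiSchramm1996, Conj. 4; §2] -/
theorem criticalContinuity (v : Heis3 × Fin 2) : theta (PatternGraph.graph P) v (criticalProbIOf (PatternGraph.graph P) v) = 0 :=
  PatternGraph.criticalContinuity P abHom connected hrange hstep v

/-- **Conj. 4 in its own shape** for the Heisenberg skew bilayer: `p_c < 1 ∧ θ_v(p_c) = 0`. [cite: BenjaminiSchramm1996, Conj. 4; §2 Conj. 1] -/
theorem conj4 (v : Heis3 × Fin 2) : criticalProb (PatternGraph.graph P) v < 1 ∧ theta (PatternGraph.graph P) v (criticalProbIOf (PatternGraph.graph P) v) = 0 :=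
  PatternGraph.conj4 P abHom connected hrange hstep v

end Heis3Skew

end Summit.CriticalPhenomena.PercolationContinuityZ3.Theorems.Transplant

end
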